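import Summits.MatrixMultiplication.MatrixMultiplication.Theorems.OutsiderSandwichNoPadding
import HarnessLib

/-!
# No refund: `m·[⟨2,2,2⟩]^N + k·[C₁]^N ≰ B·[C₁]^{N'}` at equal formats — delay never refunds

Route `OutsiderSandwich` (decomposition cell `decomp-mm`, lens 4 «minimal counterexample /
extremal reduction», gen 28, addendum), support for the aside leaf `BlockOneIsMM`
(stmt-MatrixMultiplication-27147).

The padding engine of `OutsiderSandwichNoPadding` never uses that source and target carry the
same Kronecker exponent: `not_restrictsTo_padded₂` is the same argument for `⟨B⟩ ⊠ P^{⊠N'}`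
against `⟨m⟩ ⊠ ⟨2,2,2⟩^{⊠N} ⊕ t₂` (kernel vectors `sgn·ω` of the source need `N' ≥ 1`; the
identity-pattern slice of the `⟨2,2,2⟩`-summand needs nothing).  Consequences, all at EQUAL
output formats and all invisible to the known spectral points (the quantum functionals take
the value `4` on `⟨2,2,2⟩` and on `C₁`, whose tight support carries uniform marginals):

* `not_refund`: for `N' ≥ 1`, `m ≥ 1` and `(m+k)·4^N = B·4^{N'}`,
  `m·[⟨2,2,2⟩]^N + k·[C₁]^N ≰ B·[C₁]^{N'}` — between ANY two levels of the table, an exchange that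
  fills the format exactly cannot keep coupled blocks as change;
* `not_padded_delay`: `[⟨2,2,2⟩]^N + (4^p − 1)·[C₁]^N ≰ [C₁]^{N+p}`; in particular
  (`not_padded_delay_one`) `[⟨2,2,2⟩]^N + 3·[C₁]^N ≰ [C₁]^{N+1}` for every `N`, to be read against
  the rung `delayed_three_one : [⟨2,2,2⟩]^3 ≤ [C₁]^4` (`OutsiderSandwichDelayThree`): the delay
  `C₁^{⊠4} ⊵ ⟨2,2,2⟩^{⊠3}` exists, but no delay `C₁^{⊠(N+1)} ⊵ ⟨2,2,2⟩^{⊠N}` can retain the three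
  spare blocks `⟨3⟩ ⊠ C₁^{⊠N}` that the format would allow (`not_padded_delay_tensor`);
* `not_refund_scalar`: nor `(4^p − 1)·4^N` independent scalar products instead.

## References
* D. Coppersmith, S. Winograd, *Matrix multiplication via arithmetic progressions*,
  J. Symbolic Comput. 9 (1990) 251–280, §7 (the coupled block). [CoppersmithWinograd1990]
* P. Bürgisser, M. Clausen, M. A. Shokrollahi, *Algebraic Complexity Theory*, Springer (1997),
  §14.4 (restriction, conciseness), (15.19). [BurgisserClausenShokrollahi1997]
* M. Christandl, P. Vrana, J. Zuiddam, *Universal points in the asymptotic spectrum of tensors*,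
  J. Amer. Math. Soc. 36 (2023), §1.1, Ex. 1.4. [ChristandlVranaZuiddam2023]
-/

noncomputable section
open scoped BigOperators Matrix
set_option linter.dupNamespace false
set_option autoImplicit false

namespace Summit.MatrixMultiplication.MatrixMultiplication.Theorems.OutsiderSandwichNoRefund

open Literature.Computability.AlgebraicComplexity
open Summit.MatrixMultiplication.MatrixMultiplication.Theorems.OutsiderSandwichCoupling (coupling₁)
open Summit.MatrixMultiplication.MatrixMultiplication.Theorems.OutsiderSandwichBlockNormalForm
  (pairTensor)
open Summit.MatrixMultiplication.MatrixMultiplication.Theorems.OutsiderSandwichAmortised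
  (mk_unit_kronecker_pow)
open Summit.MatrixMultiplication.MatrixMultiplication.Theorems.OutsiderSandwichNoTightExchange
open Summit.MatrixMultiplication.MatrixMultiplication.Theorems.OutsiderSandwichSliceConcise
open Summit.MatrixMultiplication.MatrixMultiplication.Theorems.OutsiderSandwichNoPadding

/-! ## 1. The engine with two exponents -/
section Engine

variable {ι₂ κ₂ μ₂ : Type} [Fintype ι₂] [Fintype κ₂] [Fintype μ₂]
variable {N N' m B : ℕ}

/-- **No padded exchange, two exponents.** For `N' ≥ 1` and any padding `t₂` concise in slice
form on both vector legs: if the output legs of `⟨B⟩ ⊠ P^{⊠N'}` and `⟨m⟩ ⊠ ⟨2,2,2⟩^{⊠N} ⊕ t₂`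
have the same size and the output leg of `t₂` is smaller than the input leg of the target, then
`⟨B⟩ ⊠ P^{⊠N'} ⋭ ⟨m⟩ ⊠ ⟨2,2,2⟩^{⊠N} ⊕ t₂`. [cite: CoppersmithWinograd1990, §7] -/
theorem not_restrictsTo_padded₂ (hN' : 1 ≤ N') (t₂ : ι₂ → κ₂ → μ₂ → ℂ)
    (hY : ∀ w, slice t₂ w = 0 → w = 0)
    (hZ : ∀ ζ, (∀ w, (slice t₂ w).mulVec ζ = 0) → ζ = 0)
    (hcardZ : Fintype.card (J N m ⊕ μ₂) = Fintype.card (J N' B))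
    (hcardY : Fintype.card μ₂ < Fintype.card (J N m ⊕ κ₂)) :
    ¬ TensorRestrictsTo (src N' B) (directSumTensor (tgt N m) t₂) := by
  classical
  rintro ⟨A, B', C, hABC⟩
  set Bt : Matrix (J N' B) (J N m ⊕ κ₂) ℂ := (Matrix.of B')ᵀ with hBt
  set Ct : Matrix (J N' B) (J N m ⊕ μ₂) ℂ := (Matrix.of C)ᵀ with hCt
  have hw : ∀ w' : J N m ⊕ κ₂ → ℂ, (fun b => ∑ b', w' b' * B' b' b) = Bt.mulVec w' := by
    intro w'; funext b
    simp only [hBt, Matrix.mulVec, dotProduct, Matrix.transpose_apply, Matrix.of_apply]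
    exact Finset.sum_congr rfl fun b' _ => mul_comm _ _
  have key : ∀ w' : J N m ⊕ κ₂ → ℂ, slice (directSumTensor (tgt N m) t₂) w' =
      Matrix.of A * slice (src N' B) (Bt.mulVec w') * Ct := by
    intro w'
    rw [← hw w']
    exact slice_restrict A B' C hABC w'
  have hCinj : ∀ ζ, Ct.mulVec ζ = 0 → ζ = 0 := by
    intro ζ hζ
    refine directSum_vec_eq_zero (fun ζ h => tgt_vec_eq_zero N m h) hZ fun w' => ?_
    rw [key w', ← Matrix.mulVec_mulVec, ← Matrix.mulVec_mulVec, hζ, Matrix.mulVec_zero,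
      Matrix.mulVec_zero]
  obtain ⟨D, hCD, -⟩ := exists_two_sided_inv Ct hcardZ hCinj
  have hBinj : ∀ w', Bt.mulVec w' = 0 → w' = 0 := by
    intro w' hw'
    refine directSum_weight_eq_zero (fun w h => tgt_weight_eq_zero N m h) hY ?_
    rw [key w', hw', slice_zero, Matrix.mul_zero, Matrix.zero_mul]
  set Sg : Matrix (J N' B) (J N' B) ℂ := Matrix.diagonal (sgn (m := B) hN') with hSg
  have hdiag : Sg * Sg = 1 := by
    rw [hSg, Matrix.diagonal_mul_diagonal, ← Matrix.diagonal_one]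
    congr 1; funext z; exact sgn_mul_self hN' z
  set G : Matrix (J N m ⊕ μ₂) (J N m ⊕ κ₂) ℂ := D * Sg * Bt with hG
  have hGB : Sg * (Ct * G) = Bt := by
    simp only [hG, ← Matrix.mul_assoc]
    rw [Matrix.mul_assoc Sg Ct D, hCD, Matrix.mul_one, hdiag, Matrix.one_mul]
  have hann : ∀ w', (slice (directSumTensor (tgt N m) t₂) w').mulVec (G.mulVec w') = 0 := by
    intro w'
    have hκ : G.mulVec w' = D.mulVec (fun z => sgn hN' z * Bt.mulVec w' z) := by
      rw [hG, ← Matrix.mulVec_mulVec, ← Matrix.mulVec_mulVec]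
      congr 1; funext z; rw [hSg]; exact Matrix.mulVec_diagonal _ _ z
    have hback : Ct.mulVec (D.mulVec fun z => sgn hN' z * Bt.mulVec w' z) =
        fun z => sgn hN' z * Bt.mulVec w' z := by
      rw [Matrix.mulVec_mulVec, hCD, Matrix.one_mulVec]
    rw [key w', hκ, ← Matrix.mulVec_mulVec, ← Matrix.mulVec_mulVec, hback, slice_mulVec_sgn hN',
      Matrix.mulVec_zero]
  have hM : ∀ (w₁ : J N m → ℂ) (w₂ : κ₂ → ℂ),
      (slice (tgt N m) w₁).mulVec (G.mulVec (Sum.elim w₁ w₂) ∘ Sum.inl) = 0 := by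
    intro w₁ w₂
    have e := hann (Sum.elim w₁ w₂)
    rw [slice_directSum, Matrix.fromBlocks_mulVec] at e
    funext a
    have ea := congrFun e (Sum.inl a)
    simp only [Sum.elim_inl, Sum.elim_inr, Pi.zero_apply, Matrix.zero_mulVec, add_zero] at ea
    exact ea
  have hlin : ∀ (w₁ w₁' : J N m → ℂ) (w₂ w₂' : κ₂ → ℂ),
      G.mulVec (Sum.elim (w₁ + w₁') (w₂ + w₂')) ∘ Sum.inl =
        G.mulVec (Sum.elim w₁ w₂) ∘ Sum.inl + G.mulVec (Sum.elim w₁' w₂') ∘ Sum.inl := by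
    intro w₁ w₁' w₂ w₂'
    rw [sum_elim_add, Matrix.mulVec_add]; rfl
  have hneg : ∀ (w₁ : J N m → ℂ) (w₂ : κ₂ → ℂ),
      G.mulVec (Sum.elim (-w₁) (-w₂)) ∘ Sum.inl = -(G.mulVec (Sum.elim w₁ w₂) ∘ Sum.inl) := by
    intro w₁ w₂
    rw [sum_elim_neg, Matrix.mulVec_neg]; rfl
  have hid : ∀ w₂ : κ₂ → ℂ, G.mulVec (Sum.elim (idWeight N m) w₂) ∘ Sum.inl = 0 := by
    intro w₂
    simpa [slice_tgt_idWeight] using hM (idWeight N m) w₂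
  have hzero : ∀ w₂ : κ₂ → ℂ, G.mulVec (Sum.elim 0 w₂) ∘ Sum.inl = 0 := by
    intro w₂
    have e := hlin (idWeight N m) 0 0 w₂
    rw [add_zero, zero_add, hid, hid, zero_add] at e
    exact e.symm
  have hu : ∀ u : J N m → ℂ, G.mulVec (Sum.elim u 0) ∘ Sum.inl = 0 := by
    intro u
    have hp := hM (idWeight N m + u) (0 + 0)
    rw [hlin, hid, zero_add, slice_add, slice_tgt_idWeight, Matrix.add_mulVec,
      Matrix.one_mulVec] at hp
    have hn := hM (idWeight N m + -u) (0 + -0)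
    rw [hlin, hid, zero_add, hneg, slice_add, slice_neg, slice_tgt_idWeight, Matrix.add_mulVec,
      Matrix.one_mulVec, Matrix.neg_mulVec, Matrix.mulVec_neg, neg_neg] at hn
    have hS : (slice (tgt N m) u).mulVec (G.mulVec (Sum.elim u 0) ∘ Sum.inl) = 0 := by
      have e := congrArg₂ (· + ·) hp hn
      rw [add_zero, add_add_add_comm, add_neg_cancel, zero_add, ← two_smul ℂ] at e
      exact (smul_eq_zero.mp e).resolve_left two_ne_zero
    rw [hS, add_zero] at hp
    exact hp
  have hrow : ∀ w' : J N m ⊕ κ₂ → ℂ, G.mulVec w' ∘ Sum.inl = 0 := by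
    intro w'
    have hsplit : w' = Sum.elim (fun b => w' (Sum.inl b)) (0 : κ₂ → ℂ)
        + Sum.elim (0 : J N m → ℂ) (fun b => w' (Sum.inr b)) := by
      funext x; rcases x with x | x <;> simp
    rw [hsplit, Matrix.mulVec_add]
    funext z
    have e1 := congrFun (hu fun b => w' (Sum.inl b)) z
    have e2 := congrFun (hzero fun b => w' (Sum.inr b)) z
    simp only [Function.comp_apply, Pi.zero_apply] at e1 e2
    simp only [Function.comp_apply, Pi.add_apply, Pi.zero_apply, e1, e2, add_zero]
  have hGinj : ∀ w', G.mulVec w' = 0 → w' = 0 := by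
    intro w' h0
    refine hBinj w' ?_
    rw [← hGB, ← Matrix.mulVec_mulVec, ← Matrix.mulVec_mulVec, h0, Matrix.mulVec_zero,
      Matrix.mulVec_zero]
  let φ : (J N m ⊕ κ₂ → ℂ) →ₗ[ℂ] (μ₂ → ℂ) :=
    (LinearMap.funLeft ℂ ℂ (Sum.inr : μ₂ → J N m ⊕ μ₂)).comp (Matrix.mulVecLin G)
  have hφ : Function.Injective φ := by
    intro v v' hvv'
    have h0 : φ (v - v') = 0 := by rw [map_sub, hvv', sub_self]
    refine sub_eq_zero.mp (hGinj _ ?_)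
    funext x
    rcases x with z | c
    · exact congrFun (hrow (v - v')) z
    · have := congrFun h0 c
      simpa [φ, LinearMap.funLeft_apply, Matrix.mulVecLin_apply] using this
  have hle := LinearMap.finrank_le_finrank_of_injective hφ
  rw [Module.finrank_fintype_fun_eq_card, Module.finrank_fintype_fun_eq_card] at hle
  exact absurd hcardY (not_lt.mpr hle)
end Engine

/-! ## 2. No refund between levels -/
section Refund

variable {N N' m : ℕ}

/-- **No refund** (pair-tensor form): for `N' ≥ 1`, `m ≥ 1` and `(m+k)·4^N = B·4^{N'}`,
`⟨B⟩ ⊠ P^{⊠N'} ⋭ ⟨m⟩ ⊠ ⟨2,2,2⟩^{⊠N} ⊕ ⟨k⟩ ⊠ P^{⊠N}`. [cite: CoppersmithWinograd1990, §7] -/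
theorem not_refund_src (hN' : 1 ≤ N') (hm : 1 ≤ m) (k B : ℕ)
    (hfmt : (m + k) * 4 ^ N = B * 4 ^ N') :
    ¬ TensorRestrictsTo (src N' B) (directSumTensor (tgt N m) (src N k)) := by
  refine not_restrictsTo_padded₂ hN' _ (fun w h => src_weight_eq_zero N k h)
    (fun ζ h => src_vec_eq_zero N k h) ?_ ?_
  · simp only [J, Fintype.card_sum, Fintype.card_prod, Fintype.card_fin, Fintype.card_fun]
    have e : (2 * 2) ^ N = 4 ^ N := by norm_num
    rw [e, ← hfmt]; ring_nf
  · simp only [J, Fintype.card_sum, Fintype.card_prod, Fintype.card_fin, Fintype.card_fun]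
    have : 0 < m * (2 * 2) ^ N := by positivity
    omega

/-- **No refund**, in the semiring: for `N' ≥ 1`, `m ≥ 1` and `(m+k)·4^N = B·4^{N'}`,
`m·[⟨2,2,2⟩]^N + k·[C₁]^N ≰ B·[C₁]^{N'}` (`N' = N`: `not_catalytic_le`).
[cite: CoppersmithWinograd1990, §7] -/
theorem not_refund (hN' : 1 ≤ N') (hm : 1 ≤ m) (k B : ℕ)
    (hfmt : (m + k) * 4 ^ N = B * 4 ^ N') :
    ¬ ((m : TensorClass ℂ) * TensorClass.mk (matMulTensor ℂ 2 2 2) ^ N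
        + (k : TensorClass ℂ) * TensorClass.mk coupling₁ ^ N
        ≤ (B : TensorClass ℂ) * TensorClass.mk coupling₁ ^ N') := by
  intro h
  rw [mk_coupling₁, ← mk_unit_kronecker_pow (matMulTensor ℂ 2 2 2) m N,
    ← mk_unit_kronecker_pow (pairTensor 2) k N, ← mk_unit_kronecker_pow (pairTensor 2) B N',
    TensorClass.mk_add_mk, TensorClass.mk_le_mk_iff] at h
  exact not_refund_src hN' hm k B hfmt h

/-- **Delay never refunds**: `[⟨2,2,2⟩]^N + (4^p − 1)·[C₁]^N ≰ [C₁]^{N+p}` whenever `N + p ≥ 1`.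
[cite: CoppersmithWinograd1990, §7] -/
theorem not_padded_delay (N p : ℕ) (hNp : 1 ≤ N + p) :
    ¬ (TensorClass.mk (matMulTensor ℂ 2 2 2) ^ N
        + ((4 ^ p - 1 : ℕ) : TensorClass ℂ) * TensorClass.mk coupling₁ ^ N
        ≤ TensorClass.mk coupling₁ ^ (N + p)) := by
  have hfmt : (1 + (4 ^ p - 1)) * 4 ^ N = 1 * 4 ^ (N + p) := by
    rw [Nat.add_sub_cancel' (Nat.one_le_pow p 4 (by norm_num)), one_mul, pow_add, mul_comm]
  have h := not_refund (N := N) hNp (le_refl 1) (4 ^ p - 1) 1 hfmt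
  rwa [Nat.cast_one, one_mul, one_mul] at h

/-- **Delay never refunds, one step**: `[⟨2,2,2⟩]^N + 3·[C₁]^N ≰ [C₁]^{N+1}` for every `N`
(compare `delayed_three_one : [⟨2,2,2⟩]^3 ≤ [C₁]^4`). [cite: CoppersmithWinograd1990, §7] -/
theorem not_padded_delay_one (N : ℕ) :
    ¬ (TensorClass.mk (matMulTensor ℂ 2 2 2) ^ N + 3 * TensorClass.mk coupling₁ ^ N
        ≤ TensorClass.mk coupling₁ ^ (N + 1)) := by
  have h := not_padded_delay N 1 (by omega)
  norm_num at h
  exact h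

/-- **Delay never refunds** (tensor form): `C₁^{⊠(N+1)} ⋭ ⟨2,2,2⟩^{⊠N} ⊕ ⟨3⟩ ⊠ C₁^{⊠N}`.
[cite: CoppersmithWinograd1990, §7] -/
theorem not_padded_delay_tensor (N : ℕ) :
    ¬ TensorRestrictsTo (kroneckerPow coupling₁ (N + 1))
        (directSumTensor (kroneckerPow (matMulTensor ℂ 2 2 2) N)
          (kroneckerTensor (unitTensor ℂ 3) (kroneckerPow coupling₁ N))) := by
  intro h
  apply not_padded_delay_one N
  have h' := TensorClass.mk_le_mk_iff.2 h
  rwa [← TensorClass.mk_add_mk, ← TensorClass.mk_pow, ← TensorClass.mk_pow,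
    mk_unit_kronecker_pow, Nat.cast_ofNat] at h'

/-- **No scalar refund**: `[⟨2,2,2⟩]^N + (4^p − 1)·4^N ≰ [C₁]^{N+p}` (`N + p ≥ 1`) — a delay cannot
even retain `(4^p − 1)·4^N` independent scalar products. [cite: CoppersmithWinograd1990, §7] -/
theorem not_refund_scalar (N p : ℕ) (hNp : 1 ≤ N + p) :
    ¬ (TensorClass.mk (matMulTensor ℂ 2 2 2) ^ N + (((4 ^ p - 1) * 4 ^ N : ℕ) : TensorClass ℂ)
        ≤ TensorClass.mk coupling₁ ^ (N + p)) := by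
  intro h
  have h1 : TensorClass.mk (tgt N 1) = TensorClass.mk (matMulTensor ℂ 2 2 2) ^ N := by
    rw [mk_unit_kronecker_pow, Nat.cast_one, one_mul]
  have h2 : TensorClass.mk (src (N + p) 1) = TensorClass.mk coupling₁ ^ (N + p) := by
    rw [mk_unit_kronecker_pow, Nat.cast_one, one_mul, mk_coupling₁]
  rw [← h1, ← h2, TensorClass.natCast_eq_mk, TensorClass.mk_add_mk,
    TensorClass.mk_le_mk_iff] at h
  refine not_restrictsTo_padded₂ hNp _ (unitTensor_weight_eq_zero _) (unitTensor_vec_eq_zero _)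
    ?_ ?_ h
  · simp only [J, Fintype.card_sum, Fintype.card_prod, Fintype.card_fin, Fintype.card_fun]
    have e4 : (2 * 2) = 4 := rfl
    have : 4 ^ N ≤ 4 ^ p * 4 ^ N := Nat.le_mul_of_pos_left _ (by positivity)
    rw [e4, pow_add, mul_comm (4 ^ N) (4 ^ p), Nat.sub_mul, one_mul]
    omega
  · simp only [J, Fintype.card_sum, Fintype.card_prod, Fintype.card_fin, Fintype.card_fun]
    have : 0 < (2 * 2) ^ N := by positivity
    omega

end Refund

end Summit.MatrixMultiplication.MatrixMultiplication.Theorems.OutsiderSandwichNoRefund
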